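import Mathlib
import Summits.HubbardSuperconductivity.HubbardSuperconductivity.Theses.FunctionFieldCertificate
import Literature.MathematicalPhysics.QuantumLattice.PairFieldMomentum
import Literature.MathematicalPhysics.QuantumLattice.HubbardWave0

/-!
# Sketch (crux-ideate round 2, ideator 6) — first lemmas for the crux idea card
`ir-safe-seed-at-coherence-scale` on `FunctionFieldCertificate.MesoscopicPairOrder`
(stmt-HubbardSuperconductivity-7331).

Everything here is a `Prop` (statement only); nothing is asserted. Vocabulary: the crux's Fejér-box
functional (verbatim), the tree's momentum pair field `pairFieldAt`, pair structure factor
`pairStructureFactor` and `momentumNormSq` (PairFieldMomentum), `spinSq` (HubbardWave0).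
-/

noncomputable section

-- the summit namespace repeats the problem name by design (D-0017)
set_option linter.dupNamespace false

namespace Summit.HubbardSuperconductivity.HubbardSuperconductivity.Cruxes.MesoscopicPairOrder.Ideator6

open Literature.MathematicalPhysics.QuantumLattice Literature.Probability.LatticeModels
open Summit.HubbardSuperconductivity.HubbardSuperconductivity.Theses.FunctionFieldCertificate
open scoped BigOperators Matrix ComplexOrder

/-- The crux's Fejér-box `d`-wave pair order PER SITE at scale `R`,
`K_R(ψ) := L⁻² Σ_{x,y} Πᵢ (1 - |(y-x)ᵢ|_L/R)₊ Re⟨P_x ψ, P_y ψ⟩` — verbatim the right-hand side of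
`MesoscopicPairOrder` (which asks `m R² ≤ K_R(ψ)`). -/
def boxOrder (L R : ℕ) [NeZero L] (ψ : Fock (Orb (FermionTorus 2 L))) : ℝ :=
  (∑ x : TorusSite 2 L, ∑ y : TorusSite 2 L,
      (∏ i : Fin 2, max 0 (1 - |(((y i - x i).valMinAbs : ℤ) : ℝ)| / (R : ℝ))) *
        (star (localPair dWaveFormFactor L x *ᵥ ψ) ⬝ᵥ (localPair dWaveFormFactor L y *ᵥ ψ)).re) /
    (L : ℝ) ^ 2

/-- Sanity: the crux is `∃ U δ m, ∀ R₀ ∃ R ≥ R₀ ∃ L₀ ∀ L ≥ L₀ even ∀ GS ψ, m R² ≤ boxOrder L R ψ`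
(definitional). -/
theorem mesoscopicPairOrder_iff_boxOrder :
    MesoscopicPairOrder ↔
      ∃ U : ℝ, 0 < U ∧ ∃ δ ∈ Set.Ioo (0:ℝ) (1 / 2), ∃ m : ℝ, 0 < m ∧ ∀ R₀ : ℕ, ∃ R : ℕ, R₀ ≤ R ∧
        ∃ L₀ : ℕ, ∀ (L : ℕ) [NeZero L], L₀ ≤ L → Even L →
          ∀ ψ : Fock (Orb (FermionTorus 2 L)), star ψ ⬝ᵥ ψ = 1 →
            IsGroundStateInSector (hubbardTorus 2 L 1 U) (2 * ⌊(1 - δ) * (L : ℝ) ^ 2 / 2⌋₊) 0 ψ →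
              m * (R : ℝ) ^ 2 ≤ boxOrder L R ψ :=
  Iff.rfl

/-! ### The two halves of the card's transfer `C⁺ = Seed ∧ PointwiseWindow` -/

/-- **SEED at ONE scale** `R₀` (every ground state): at `(U, δ)`, for all even `L ≥ L₀`, every
normalised `(N_L, S^z = 0)`-sector ground state of `hubbardTorus 2 L 1 U` has Fejér-box `d`-wave order
`m₀ R₀² ≤ K_{R₀}(ψ)`. The crux with `∀ R₀ ∃ R ≥ R₀` replaced by a single `R₀`; the card pins
`R₀ ≍ ξ_U` (BCS coherence length) where the statement is INFRARED-SAFE (range-`R₀` observable). -/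
def SeedAtScale (U δ m₀ : ℝ) (R₀ : ℕ) : Prop :=
  ∃ L₀ : ℕ, ∀ (L : ℕ) [NeZero L], L₀ ≤ L → Even L →
    ∀ ψ : Fock (Orb (FermionTorus 2 L)), star ψ ⬝ᵥ ψ = 1 →
      IsGroundStateInSector (hubbardTorus 2 L 1 U) (2 * ⌊(1 - δ) * (L : ℝ) ^ 2 / 2⌋₊) 0 ψ →
        m₀ * (R₀ : ℝ) ^ 2 ≤ boxOrder L R₀ ψ

/-- **POINTWISE window bound** (Landau/Goldstone form, the card's strengthened pole half): at
`(U, δ)`, for all even `L ≥ L₀` and every normalised sector ground state, the `d`-wave pair structure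
factor `S_ψ(m) = ‖Δ_d(m)ψ‖²/L²` obeys `S_ψ(m) ≤ S_flat + A/|q_m|` for all window momenta
`0 < |q_m| ≤ ε₀` (`|q_m|² = momentumNormSq L m`). A flat normal background `S_flat` plus a true
`(2+1)`-dimensional Goldstone pole `A/|q|` — NOT the Σ-form `Σ_{window} S_ψ ≤ C ε L²` of stmt-1089
(which it implies with `C ≈ S_flat ε₀/4π + A/2π`). -/
def PointwiseWindowAt (U δ S A ε₀ : ℝ) : Prop :=
  ∃ L₀ : ℕ, ∀ (L : ℕ) [NeZero L], L₀ ≤ L → Even L →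
    ∀ ψ : Fock (Orb (FermionTorus 2 L)), star ψ ⬝ᵥ ψ = 1 →
      IsGroundStateInSector (hubbardTorus 2 L 1 U) (2 * ⌊(1 - δ) * (L : ℝ) ^ 2 / 2⌋₊) 0 ψ →
        ∀ m : TorusSite 2 L, m ≠ 0 → momentumNormSq L m ≤ ε₀ ^ 2 →
          pairStructureFactor dWaveFormFactor L ψ m ≤ S + A / Real.sqrt (momentumNormSq L m)

/-! ### FIRST LEMMA (provable now): the pointwise one-scale closure -/

/-- **Pointwise one-scale closure with constant `c`** (pure Fejér/Parseval arithmetic on `(ℤ/Lℤ)²`,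
one vector, one side `L`; the pointwise twin of the tree's `pairOrder_ge_seed_sub_window_sub_tail`,
p109534): if a unit vector `ψ` has box order `m₀ R₀² ≤ K_{R₀}(ψ)` at ONE scale `0 < R₀`, `2R₀ ≤ L`, and
pointwise caps `S_ψ(m) ≤ S + A/|q_m|` on the window `0 < |q_m| ≤ ε`, then its zero-momentum pair order
`L⁻⁴ Re⟨ψ, Δ_dᴴΔ_d ψ⟩ = S_ψ(0)/L²` is at least `m₀ - S/R₀² - c·A/R₀ - 64π²/(R₀² ε²)`:
flat leakage EXACTLY `S (1/R₀² - 1/L²)` (Parseval of the tent, `Σ_q Ŵ_{R₀}(q) = L²`), Goldstone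
leakage `L⁻² Σ_{0<|q|≤ε} (Ŵ_{R₀}(q)/R₀²)/|q| ≤ c/R₀` (`Ŵ/R² ≤ ∏ᵢ min(1, π²/(R₀² qᵢ²))`; numerically
`c ≈ 0.32–0.46`, TRIAGE-r1-3 §Numbers), tail `≤ 64π²/(R₀² ε²)` as in the tree. -/
def PointwiseClosureWith (c : ℝ) : Prop :=
  ∀ (L : ℕ) [NeZero L] (R₀ : ℕ) (ε S A m₀ : ℝ), 0 < R₀ → 2 * R₀ ≤ L → 0 < ε → ε ≤ Real.pi →
    0 ≤ S → 0 ≤ A →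
    ∀ ψ : Fock (Orb (FermionTorus 2 L)), star ψ ⬝ᵥ ψ = 1 →
      m₀ * (R₀ : ℝ) ^ 2 ≤ boxOrder L R₀ ψ →
      (∀ m : TorusSite 2 L, m ≠ 0 → momentumNormSq L m ≤ ε ^ 2 →
          pairStructureFactor dWaveFormFactor L ψ m ≤ S + A / Real.sqrt (momentumNormSq L m)) →
        m₀ - S / (R₀ : ℝ) ^ 2 - c * A / (R₀ : ℝ) - 64 * Real.pi ^ 2 / ((R₀ : ℝ) ^ 2 * ε ^ 2) ≤
          pairStructureFactor dWaveFormFactor L ψ 0 / (L : ℝ) ^ 2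

/-- **FIRST LEMMA of the line**: the pointwise closure holds with SOME universal constant `c`. -/
def PointwiseOneScaleClosure : Prop :=
  ∃ c : ℝ, 0 < c ∧ PointwiseClosureWith c

/-! ### Composition target (provable from the first lemma + the tree's necessity lemma
`mesoscopicPairOrder_of_uniformPairOrder` / Fejér floor `fejerBox_floor_pairField`) -/

/-- **Seed + pointwise window + margin ⇒ the crux.** For a closure constant `c`: a seed at ONE scale
`R₀` with margin `m₀`, pointwise window caps `(S, A, ε)` at the same `(U, δ)`, and the scalar margin
`0 < m := m₀ - S/R₀² - c A/R₀ - 64π²/(R₀² ε²)` give uniform sector LRO `≥ m` for every ground state of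
every large even torus, hence `MesoscopicPairOrder` (margin `m`, at EVERY scale, by the Fejér floor).
The binding condition `S/R₀² < m₀ ≈ a` fixes the seed scale: `R₀ ≳ √(2 S_flat/a)` — at weak coupling
`≍ ξ_U` (the card's point), NOT the `21/a` forced by the Σ-form window of stmt-1089. -/
def SeedAndPointwiseWindowGiveCrux : Prop :=
  ∀ c : ℝ, 0 < c → PointwiseClosureWith c →
    ∀ (U δ m₀ S A ε : ℝ) (R₀ : ℕ), 0 < U → δ ∈ Set.Ioo (0:ℝ) (1 / 2) → 0 < R₀ → 0 < ε →
      ε ≤ Real.pi → 0 ≤ S → 0 ≤ A →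
      0 < m₀ - S / (R₀ : ℝ) ^ 2 - c * A / (R₀ : ℝ) - 64 * Real.pi ^ 2 / ((R₀ : ℝ) ^ 2 * ε ^ 2) →
      SeedAtScale U δ m₀ R₀ → PointwiseWindowAt U δ S A ε → MesoscopicPairOrder

/-! ### The card's transfer `C⁺` at weak coupling -/

/-- **IR-SAFE SEED AT THE COHERENCE SCALE (weak-coupling corner), the card's `C⁺`.** At hole doping
`δ` (inside the `B₁g` Kohn–Luttinger window, `0.6 < 1-δ < 1`, Raghu–Kivelson–Scalapino 2010 p. 7) there
is `U₀ > 0` such that for EVERY `0 < U < U₀` the Hubbard torus has, at some single scale `R₀ = R₀(U)`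
(expected `≍ ξ_U`, the BCS coherence length, `ln ξ_U ≍ α₂(δ)/U²`), a seed with margin `m₀(U)` and a
pointwise window `(S, A, ε)` whose closure margin is positive. Stronger than needed for the crux (one
`U` suffices) but it is the form a weak-coupling construction outputs, on an OPEN `U`-window (which is
what the generic-`U` Schur reduction of the ∀-ground-state quantifier needs). -/
def IRSafeSeedWeakCoupling (δ c : ℝ) : Prop :=
  ∃ U₀ : ℝ, 0 < U₀ ∧ ∀ U ∈ Set.Ioo (0:ℝ) U₀, ∃ (m₀ S A ε : ℝ) (R₀ : ℕ),
    0 < R₀ ∧ 0 < ε ∧ ε ≤ Real.pi ∧ 0 ≤ S ∧ 0 ≤ A ∧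
    0 < m₀ - S / (R₀ : ℝ) ^ 2 - c * A / (R₀ : ℝ) - 64 * Real.pi ^ 2 / ((R₀ : ℝ) ^ 2 * ε ^ 2) ∧
    SeedAtScale U δ m₀ R₀ ∧ PointwiseWindowAt U δ S A ε

/-- `C⁺ ⇒ crux` (given the first lemma and the composition): pure logic, recorded as the target a
crux-plan seat would kernel-check as `MesoscopicPairOrder_of`. -/
def IRSafeSeedGivesCrux : Prop :=
  ∀ (δ c : ℝ), δ ∈ Set.Ioo (0:ℝ) (1 / 2) → 0 < c → PointwiseClosureWith c →
    SeedAndPointwiseWindowGiveCrux → IRSafeSeedWeakCoupling δ c → MesoscopicPairOrder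

/-- The composition is indeed pure logic (sanity proof, no sorry). -/
theorem irSafeSeedGivesCrux : IRSafeSeedGivesCrux := by
  intro δ c hδ hc hclos hcomp hC
  obtain ⟨U₀, hU₀, h⟩ := hC
  obtain ⟨m₀, S, A, ε, R₀, hR₀, hε, hεπ, hS, hA, hmargin, hseed, hwin⟩ :=
    h (U₀ / 2) ⟨by linarith, by linarith⟩
  exact hcomp c hc hclos (U₀ / 2) δ m₀ S A ε R₀ (by linarith) hδ hR₀ hε hεπ hS hA hmargin hseed hwin

/-! ### Support S0 (provable now, variational): the weak-coupling corner lies outside the disprover's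
only exclusion region (saturated ferromagnetism, Disproof.lean §2) -/

/-- **No saturated-ferromagnetic sector ground states at `U ≤ 6`, `δ ∈ [1/10, 3/10]`, eventually in
`L`.** Proof route (finite-dimensional, free-fermion energies on the torus): a saturated state in the
`(N_L, 0)` sector has energy `= ` the ground energy of `N_L` SPINLESS free fermions `≈ ε₁(1-δ) L²`
(`ε₁(ν)` = one-species free kinetic energy density; `ε₁(0.8) = ε₁(0.2) = -0.574`, `ε₁(0.7) = -0.719`),
while the paramagnetic Slater determinant `|FS↑(N_L/2)⟩ ⊗ |FS↓(N_L/2)⟩` lies in the sector with energy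
`2ε₁((1-δ)/2) L² + U (1-δ)² L²/4 + O(L)` (`= -1.583 + 0.16 U` per site at `δ = 1/5`), strictly lower
for `U < 6.3` (`δ = 1/5`), `U < 6.6` (`δ = 3/10`), `U < 6.2` (`δ = 1/10`). Hence
`¬ SaturatedGroundStatesFrequently U δ` there, discharging `mesoscopicPairOrderAt_false_of_saturated`
for the card's corner. -/
def NoSaturatedFerromagnetWeakCoupling : Prop :=
  ∀ U ∈ Set.Ioc (0:ℝ) 6, ∀ δ ∈ Set.Icc (1 / 10 : ℝ) (3 / 10), ∃ L₀ : ℕ, ∀ (L : ℕ) [NeZero L],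
    L₀ ≤ L → Even L → ∀ ψ : Fock (Orb (FermionTorus 2 L)),
      IsGroundStateInSector (hubbardTorus 2 L 1 U) (2 * ⌊(1 - δ) * (L : ℝ) ^ 2 / 2⌋₊) 0 ψ →
        spinSq *ᵥ ψ ≠ (((⌊(1 - δ) * (L : ℝ) ^ 2 / 2⌋₊ : ℝ) *
          ((⌊(1 - δ) * (L : ℝ) ^ 2 / 2⌋₊ : ℝ) + 1) : ℝ) : ℂ) • ψ

end Summit.HubbardSuperconductivity.HubbardSuperconductivity.Cruxes.MesoscopicPairOrder.Ideator6

end
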